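import Summits.CriticalPhenomena.SAWScalingLimit.Theorems.SAWLeftRightFKGLeftRightFKGNotchedBoxWalk
import Summits.CriticalPhenomena.SAWScalingLimit.Theorems.SAWLeftRightFKGLeftRightFKGNotchThreePoint
import Summits.CriticalPhenomena.SAWScalingLimit.Theorems.SAWLeftRightFKGLeftRightFKGNotchUpClosed
import Summits.CriticalPhenomena.SAWScalingLimit.Theorems.SAWLeftRightFKGLeftRightFKGNotch54Cert
import HarnessLib

/-!
# Left–right association FAILS at every fugacity `0.61 ≤ x ≤ 1` (crux `LeftRightFKG`, lead c4): a certified supercritical interval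

Crux `stmt-CriticalPhenomena-11232` (`…Theses.SAWLeftRightFKG.LeftRightFKG` asserts left–right positive association of the SAW
chord measure AT `x_c ≈ 0.379`). The route's guard `NotFKGAtOne` (stmt-11233, landed) records failure at `x = 1` (counting measure).
Here: **`¬ CornerLoc.PA x` for EVERY `61/100 ≤ x ≤ 1`** — the graded association statement of the line's vocabulary
(`Theorems/SAWLeftRightFKGLeftRightFKGDefs.lean`; at `k = m = 0`, `Sa = Sb = univ` it is the crux at fugacity `x`) fails on a whole
interval of supercritical fugacities. Mechanism (all landed today, namespace `…Theorems.LeftRightFKG.Families`): on the `5 × 4` NOTCHED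
box (walls `0,6,0,5`, bottom-row notch `s = (3,1)` carried by a unit spur of the boundary walk — `stub_notchedBoxWalk`), with the diagonal
marked pair `a = (2,1)`, `b = (3,2)` (`a' = (2,0)` on the wall, `b' = s`), the events `{first step West}`, `{last step not from v}` are
`≼`-up-closed (`stub_notchUpClosed`), `PA x` yields one inequality which the class dictionary reads as the two-chain three-point
inequality `Z_G(W,v)·(Z_G(v,E_b)+Z_G(v,N_b)) ≤ Z_G(W,E_b)+Z_G(W,N_b)` in the 17-site free graph (`stub_notchThreePointOfIneq`), while the
kernel-checked certificate `stub_notch54Cert` (exact path-count polynomials: 621 paths from `W = (1,1)`, 628 from `v = (2,2)`;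
`R·Q − P = x⁴(−1 − 2x² − x⁴ + 6x⁶ + 35x⁸ + 77x¹⁰ + 98x¹² + 100x¹⁴ + 99x¹⁶ + 96x¹⁸ + 86x²⁰ + 64x²² + 34x²⁴ + 9x²⁶)`, one sign
change, root in `(0.60, 0.61)`; `PolyMP.posOn` on `[61/100, 1]`) gives the reverse strict inequality. Exact small-box data (lead's
enumeration) for where the same mechanism bites on larger instances: notched boxes `6×5 / 7×5 / 7×6`: sign change at `x ≈ .58 / .54 / .52`;
bottom-corner minors (`…BoxCornerMinor`) of `5×5 / 6×5 / 6×6` boxes: `.53 / .50 / .49` — descending towards `x_c`, as the dense-phase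
scaling `e^{2fA}` vs `e^{fA}` of the two sides predicts (x_c-sharpness programme; remaining input: thermodynamic limit of supercritical
two-point SAW kernels in boxes). Everything here is proved ("folklore").
-/

noncomputable section

open MeasureTheory
open Literature.Probability.LatticeModels Literature.Probability.RandomPlanarGeometry
open Summit.CriticalPhenomena.SAWScalingLimit.Theorems.LeftRightFKG.Negative (bx pathCross wcross)
open Summit.CriticalPhenomena.SAWScalingLimit.Theorems.LeftRightFKG.CornerLoc
open Summit.CriticalPhenomena.SAWScalingLimit.Theorems.BoundaryTP2 (pathKernel pathKernelOn)
open scoped Classical ENNReal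

namespace Summit.CriticalPhenomena.SAWScalingLimit.Theorems.LeftRightFKG.Families

/-- **Left–right association fails at every fugacity `61/100 ≤ x ≤ 1`.** `CornerLoc.PA x` (the graded left–right positive
association statement at fugacity `x`; the crux is its `k = m = 0`, `x = x_c` instance) is FALSE for all `x ∈ [0.61, 1]`: on the
`5 × 4` notched box it would force the two-chain three-point inequality at `v = (2,2)`, which the certificate `stub_notch54Cert`
refutes on that interval. [folklore] -/
theorem not_PA_of_ge : ∀ (x : ℝ), (61 / 100 : ℝ) ≤ x → x ≤ 1 → ¬ PA x := by
  intro x hlo hhi hPA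
  have hx : 0 < x := lt_of_lt_of_le (by norm_num) hlo
  obtain ⟨C, ha', hs, -, hadj⟩ := stub_notchedBoxWalk 0 6 0 5 3 (by norm_num) (by norm_num) (by norm_num)
  obtain ⟨hE, hF⟩ := stub_notchUpClosed 0 6 0 5 3 C (by norm_num) (by norm_num) (by norm_num) hadj
  have hInst : IsInst 1 (bx (3 - 1) (0 + 1)) (bx 3 (0 + 2)) (bx (3 - 1) 0) (bx 3 (0 + 1)) C :=
    ⟨one_pos, ha', hs, Negative.adj_bx _ _ _ _ (by norm_num), Negative.adj_bx _ _ _ _ (by norm_num)⟩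
  have key := hPA 1 (bx 0 0) (bx (3 - 1) (0 + 1)) (bx 3 (0 + 2)) (bx (3 - 1) 0) (bx 3 (0 + 1)) C hInst
    0 (fun _ => bx (3 - 1) (0 + 1)) 0 (fun _ => bx 3 (0 + 2)) Set.univ Set.univ _ _
    (isUpOn_of_isUp hE) (isUpOn_of_isUp hF) (by simp) (by simp)
  simp only [restrP_zero_univ, Set.inter_univ] at key
  have h3 := stub_notchThreePointOfIneq x 0 6 0 5 3 C hx (by norm_num) (by norm_num) (by norm_num) hadj key _ rfl
  -- the free graph of the instance is the lattice graph on the 17 listed sites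
  have hG : ∀ p q : Site 2, (freeGraph (dom C 1) 1 0 (fun _ => bx (3 - 1) (0 + 1)) 0 (fun _ => bx 3 (0 + 2))).Adj p q ↔
      (zdGraph 2).Adj p q ∧ p ∈ Negative.Rect.box 0 6 0 5 \ {bx 3 1, bx 2 1, bx 3 2} ∧
        q ∈ Negative.Rect.box 0 6 0 5 \ {bx 3 1, bx 2 1, bx 3 2} := by
    intro p q
    rw [freeGraph_adj, hadj]
    have hfix : ∀ w : Site 2, w ∈ fixedSet 0 (fun _ => bx (3 - 1) (0 + 1)) 0 (fun _ => bx 3 (0 + 2)) ↔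
        w = bx 2 1 ∨ w = bx 3 2 := by
      intro w
      simp only [fixedSet, Set.mem_setOf_eq, Nat.le_zero, exists_eq_left]
      constructor
      · rintro (h | h) <;> [left; right] <;> rw [← h] <;> rfl
      · rintro (rfl | rfl) <;> [left; right] <;> rfl
    simp only [hfix, Set.mem_sdiff, Set.mem_insert_iff, Set.mem_singleton_iff, not_or]
    tauto
  have hcert := stub_notch54Cert _ x hG hlo hhi
  have e1 : bx (3 - 2) (0 + 1) = bx 1 1 := rfl
  have e2 : bx (3 - 1) (0 + 2) = bx 2 2 := rfl
  have e3 : bx (3 + 1) (0 + 2) = bx 4 2 := rfl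
  have e4 : bx 3 (0 + 3) = bx 3 3 := rfl
  rw [e1, e2, e3, e4] at h3
  exact absurd h3 (not_le.2 hcert)

/-- In particular **left–right association fails at some fugacity strictly between `x_c` and `1`** (e.g. `x = 61/100 > 5/13 ≥ x_c`,
`SAW.criticalFugacity_le_five_thirteenths`-free form: we only record `61/100 < 1`). [folklore] -/
theorem exists_lt_one_not_PA : ∃ x : ℝ, x < 1 ∧ ¬ PA x :=
  ⟨61 / 100, by norm_num, not_PA_of_ge _ le_rfl (by norm_num)⟩

end Summit.CriticalPhenomena.SAWScalingLimit.Theorems.LeftRightFKG.Families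

end
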